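import Summits.QuantumFields.YangMills.Theorems.AllWindowsColdBoxBulkMidKernelDipoleOfLandau

/-!
# LINE-18 «BulkMidWindowSU2 birth v5», obligation K3′ `DirHarmonicMaxPrincipleFlux` (and v3's K3 `DirHarmonicMaxPrinciple`):
# the Props, VERBATIM from the registered skeleton (planner ym-idea-2 g14, sha16 `3c750a3750a2f49e`), crux ⟨stmt-QuantumFields-24006⟩

The registered stub S5 of LINE-18 v5 is `stub_harmonicMaxPrincipleFlux : DirHarmonicMaxPrincipleFlux`.  Following the line's precedent for K1
(`…AllWindowsColdBoxBulkMidKernelDipoleOfLandau`: the skeleton's `plaqDist` / `DirKernelDipoleDecay` copied verbatim into the by-name namespace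
`…Theorems.AllWindowsColdBoxBulkMidLine`), this file copies the two max-principle Props of the skeleton VERBATIM (same names, same bodies) into
that namespace, together with the skeleton's own one-line weakening `dirHarmonicMaxPrinciple_of_flux` (K3′ ⇒ K3), so that the by-name file
`theorem stub_harmonicMaxPrincipleFlux : DirHarmonicMaxPrincipleFlux` agrees literally with the registered signature.

* `DirHarmonicMaxPrincipleFlux` (K3′): for the Maxwell-energy minimiser `glue ϑ (mean ϑ)` of the temporal-gauge Dirichlet problem of the cold
  box (`dirFreeEdges H`, enlarged vertex box `{−1,…,2H+1}⁴ = dirCorner + {0,…,2H+2}⁴`), the squared circulation at EVERY plaquette key `p` is at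
  most `c (1 + log H)⁴ · B` whenever every plaquette key `q` whose four edges lie outside `dirFreeEdges H` has `(sCirc (glue ϑ 0) q)² ≤ B`.
* `DirHarmonicMaxPrinciple` (v3's K3): the same conclusion from the bound on ALL `q`.

REMARK (recorded for the planner; proved in the sibling files): as typed, the hypothesis of K3′ ranges over every `q : Plaq 4` with four
non-free edges — this includes the plaquette keys that STRADDLE the outer boundary of the enlarged box, for which `sCirc (glue ϑ 0) q` is a
single shell-edge value `±ϑ e` (the other three edges are not edges of the enlarged box, where `glue` is `0`).  Hence the typed hypothesis also
pins the datum's VALUES on the outer shell, and K3′ follows from K1 (`DirKernelDipoleDecay`, ✓) by an explicit admissible competitor; the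
gauge-invariant strengthening (hypothesis and conclusion restricted to plaquettes of the enlarged box) is a different, stronger statement.

Definitions only (plus the skeleton's trivial implication); HONEST LABEL: no stub, crux, rung or summit is proved here; the Yang–Mills mass gap
is NOT proved by this file.
-/

set_option autoImplicit false

noncomputable section

open Literature.MathematicalPhysics.QuantumFieldTheory
open Literature.MathematicalPhysics.QuantumFieldTheory.LatticeMaxwell
open Summit.QuantumFields.YangMills.Theorems.WeakCouplingRates

namespace Summit.QuantumFields.YangMills.Theorems.AllWindowsColdBoxBulkMidLine

/-- **Obligation K3′ of LINE-18 (verbatim from the skeleton v5): the FLUX maximum principle for the harmonic extension** — the field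
strength of the Maxwell-energy minimiser `glue ϑ (mean ϑ)` with pinned data `ϑ` is bounded everywhere by the data's circulations over the
plaquette keys all of whose edges lie outside `dirFreeEdges H`, up to `(1 + log H)⁴` on squares. -/
def DirHarmonicMaxPrincipleFlux : Prop :=
  ∃ c : ℝ, 0 < c ∧ ∀ H : ℕ, 1 ≤ H → ∀ ϑ : Literature.MathematicalPhysics.QuantumLattice.ZdEdge 4 → ℝ, ∀ B : ℝ,
    (∀ q : Plaq 4, (q.1, q.2.1) ∉ dirFreeEdges H → (q.1 + Pi.single q.2.1 1, q.2.2) ∉ dirFreeEdges H →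
        (q.1 + Pi.single q.2.2 1, q.2.1) ∉ dirFreeEdges H → (q.1, q.2.2) ∉ dirFreeEdges H →
        (sCirc (glue (pin := fun e => e ∉ dirFreeEdges H) dirCorner (2 * H + 3) ϑ 0) q) ^ 2 ≤ B) →
      ∀ p : Plaq 4,
        (sCirc (glue (pin := fun e => e ∉ dirFreeEdges H) dirCorner (2 * H + 3) ϑ
            (mean (fun e => e ∉ dirFreeEdges H) dirCorner (2 * H + 3) ϑ)) p) ^ 2 ≤
          c * (1 + Real.log H) ^ 4 * B

/-- v3's K3 (verbatim from the skeleton v5, kept for the record): the same conclusion from the stronger hypothesis «all circulations of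
`glue ϑ 0` are `≤ B`». -/
def DirHarmonicMaxPrinciple : Prop :=
  ∃ c : ℝ, 0 < c ∧ ∀ H : ℕ, 1 ≤ H → ∀ ϑ : Literature.MathematicalPhysics.QuantumLattice.ZdEdge 4 → ℝ, ∀ B : ℝ,
    (∀ q : Plaq 4, (sCirc (glue (pin := fun e => e ∉ dirFreeEdges H) dirCorner (2 * H + 3) ϑ 0) q) ^ 2 ≤ B) →
      ∀ p : Plaq 4,
        (sCirc (glue (pin := fun e => e ∉ dirFreeEdges H) dirCorner (2 * H + 3) ϑ
            (mean (fun e => e ∉ dirFreeEdges H) dirCorner (2 * H + 3) ϑ)) p) ^ 2 ≤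
          c * (1 + Real.log H) ^ 4 * B

/-- K3′ ⇒ K3 (weakening the hypothesis; the skeleton's own kernel-checked direction of the v4 re-typing). -/
theorem dirHarmonicMaxPrinciple_of_flux (h : DirHarmonicMaxPrincipleFlux) : DirHarmonicMaxPrinciple := by
  obtain ⟨c, hc, hH⟩ := h
  exact ⟨c, hc, fun H hH1 ϑ B hB p => hH H hH1 ϑ B (fun q _ _ _ _ => hB q) p⟩

end Summit.QuantumFields.YangMills.Theorems.AllWindowsColdBoxBulkMidLine

end
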